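import Mathlib
import HarnessLib
import Summits.Ventures.LatticeQCDFlow.Scoring.ReversibleKernelTauIntFloor
import Summits.Ventures.LatticeQCDFlow.Scoring.DoeblinGreenKubo
import Summits.Ventures.LatticeQCDFlow.Exactness.IMHKernel
import Summits.Ventures.LatticeQCDFlow.Scaling.TunnellingLaws

/-!
# The bottleneck floor on the fitness `τ_int`: a sector left with stationary flux `Φ` per step has
# `τ_int(1_A) ≥ π(A)(1 − π(A))/Φ − 1/2` for every reversible exact sampler; mode collapse prices itself

HONEST FRAMING: exact (Metropolis-corrected) sampling algorithms for lattice gauge theory;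
figures of merit are autocorrelation/cost numbers at stated couplings and volumes; no
continuum-physics claim.

Venture `LatticeQCDFlow` (cell pub-lqcd), topic `Scoring`; FANOUT row 8 (`s0-cpn-nemc`, GEN-12).
NEW WORK of the cell, not a published result; no definition is introduced.  Composition of three tree
theorems: the general-state-space Madras–Slade floor `(1 + ρ₁)/(2(1 − ρ₁)) ≤ τ_int` for reversible
kernels (`Scoring/ReversibleKernelTauIntFloor.lean`, `tauInt_ge_of_isReversible`), theory-2's
kernel law for exact samplers (`Scaling/TunnellingLaws.lean`, `compProd_chargeChange_le_of_invariant`: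
the stationary one-step tunnelling probability is `≤ 2·π(B)` for a separating set `B`), and row 30's
sector-entry bound for the flow-MCMC kernel (`Exactness/IMHKernel.lean`,
`indepMH_apply_le_of_not_mem`: `K(x, B) ≤ q(B)` for `x ∉ B`).  Printed counterparts, NAMED ONLY:
the conductance / bottleneck inequalities of Markov-chain theory (Lawler–Sokal 1988; Sinclair–Jerrum
1989; Madras–Slade 1993 Prop. 9.2.2) and the printed diagnosis of topological freezing
(Del Debbio–Manca–Vicari 2004: `τ_top ∼ e^{F_b}`).

## Content (`κ` Markov with invariant probability law `π`; a measurable event `A` — a topological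
## sector — with `a = π(A) ∈ (0, 1)`; `g = 1_A − a` its centred indicator; the STAY MASS
## `s = ∫_A κ(x, A) dπ` and the EXIT FLUX `Φ = a − s = (π ⊗ κ)(A × Aᶜ)` per step in equilibrium)

* `abs_centredIndicator_le`, `integrable_indicator_one`, `kop_indicator`, `autocov_centredIndicator_zero` (`C_g(0) = a(1 − a)`),
  **`autocov_centredIndicator_one`** (`C_g(1) = s − a²`, i.e. `1 − ρ₁ = Φ/(a(1 − a))`: the lag-one
  decorrelation of a sector indicator IS the normalised exit flux); `flux_eq_compProd`
  (`a − s = (π ⊗ₘ κ)(A ×ˢ Aᶜ)`, the dictionary to theory-2's pair laws).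
* **`tauInt_sector_ge_bottleneck`** — for every `π`-REVERSIBLE Markov kernel and every sector with
  positive exit flux and a summable autocorrelation: `a(1 − a)/(a − s) − 1/2 ≤ τ_int(1_A)` on the
  tree's `Scoring.tauInt` — few tunnelling events per step ⇒ certified-large autocorrelation time of
  the sector indicator, whatever the (reversible, exact) algorithm; `tauInt_sector_ge_of_flux_le` —
  monotone form with any upper bound `Φ ≤ T` on the flux.
* **`tauInt_sector_ge_of_separating`** — with theory-2's separating set `B` for a charge `Q` along
  the a.s. move relation `R` of the kernel: `a(1 − a)/(2 π(B)) − 1/2 ≤ τ_int(1_{Q ∈ S})` — the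
  free-energy-barrier law `τ_top ≳ 1/π(between the sectors)` as a theorem on the fitness, four times
  theory-2's reading constant `a(1 − a)/(4m)` (`m = 2π(B)`) and with the `−1/2` exact.
* **`indepMH_tauInt_sector_ge_modeCollapse`** — MODE COLLAPSE PRICES ITSELF: for the exact flow-MCMC
  kernel `indepMH q w` (target `π = w · q`), a sector whose complement the MODEL under-covers,
  `q(Aᶜ)` small, has `(1 − π(A))/q(Aᶜ) − 1/2 ≤ τ_int(1_A)` (exit flux `≤ π(A) q(Aᶜ)` by the
  sector-entry bound; reversibility is row 30's `indepMH_isReversible`) — e.g. a flow putting model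
  mass `10⁻³` on sectors of target mass `0.3` certifies `τ_int ≥ 299.5` for the sector indicator of
  the EXACT chain, at any mean acceptance.

Hypotheses kept explicit and honest: reversibility (HMC, Metropolis, flow-IMH, single-site heat bath
qualify; the non-reversible systematic sweep does not — theory-2's linear-in-lag floor
`sectorAutocov_ge` covers it), positive exit flux, and summability of the autocorrelation series
(automatic under a Doeblin constant, `Scoring/DoeblinWindowBracket.summable_acf_of_doeblin`).
NOT CLAIMED: any number of ours; the size of `π(B)` or `q(Aᶜ)` for a given sampler and action
(theory-2's `FluxTunnelling*.lean` / measured).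
-/

noncomputable section

namespace Summit.Ventures.LatticeQCDFlow.Scoring

open MeasureTheory ProbabilityTheory Filter Set Summit.Ventures.LatticeQCDFlow.Exactness
open scoped ENNReal

variable {Ω : Type*} [MeasurableSpace Ω]

/-! ### §1 The centred indicator of a sector: `C(0) = a(1 − a)`, `C(1) = s − a²` -/

section Indicator

variable {κ : Kernel Ω Ω} [IsMarkovKernel κ] {π : Measure Ω} [IsProbabilityMeasure π] {A : Set Ω}

/-- `|1_A − π(A)| ≤ 1`. -/
theorem abs_centredIndicator_le (A : Set Ω) (x : Ω) :
    |A.indicator (1 : Ω → ℝ) x - π.real A| ≤ 1 := by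
  have h0 : 0 ≤ π.real A := measureReal_nonneg
  have h1 : π.real A ≤ 1 := by
    have h := measureReal_mono (μ := π) (Set.subset_univ A)
    rwa [probReal_univ] at h
  by_cases hx : x ∈ A
  · rw [Set.indicator_of_mem hx, Pi.one_apply, abs_le]
    constructor <;> linarith
  · rw [Set.indicator_of_notMem hx, zero_sub, abs_neg, abs_of_nonneg h0]
    exact h1

/-- The centred indicator is measurable. -/
theorem measurable_centredIndicator (hA : MeasurableSet A) (a : ℝ) :
    Measurable fun x => A.indicator (1 : Ω → ℝ) x - a :=
  (measurable_const.indicator hA).sub measurable_const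

/-- The indicator of a measurable set is integrable against a probability law. -/
theorem integrable_indicator_one (hA : MeasurableSet A) :
    Integrable (A.indicator (1 : Ω → ℝ)) π :=
  (integrable_const (1 : ℝ)).indicator hA

/-- The centred indicator is `π`-centred. -/
theorem integral_centredIndicator (hA : MeasurableSet A) :
    ∫ x, (A.indicator (1 : Ω → ℝ) x - π.real A) ∂π = 0 := by
  rw [integral_sub (integrable_indicator_one hA) (integrable_const _),
    integral_indicator_one hA, integral_const, probReal_univ, one_smul, sub_self]

omit [IsMarkovKernel κ] in
/-- `kop κ 1_A (x) = κ(x, A)`. -/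
theorem kop_indicator (hA : MeasurableSet A) (x : Ω) :
    kop κ (A.indicator (1 : Ω → ℝ)) x = (κ x).real A := by
  unfold kop
  exact integral_indicator_one hA

omit [IsMarkovKernel κ] in
/-- `C_g(0) = a(1 − a)` for the centred indicator `g = 1_A − a`, `a = π(A)`. -/
theorem autocov_centredIndicator_zero (hA : MeasurableSet A) :
    autocov κ π (fun x => A.indicator (1 : Ω → ℝ) x - π.real A) 0 = π.real A * (1 - π.real A) := by
  rw [autocov_zero]
  have h : (fun x => (A.indicator (1 : Ω → ℝ) x - π.real A) ^ 2)
      = fun x => (1 - 2 * π.real A) * A.indicator (1 : Ω → ℝ) x + π.real A ^ 2 := by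
    funext x
    by_cases hx : x ∈ A
    · simp [hx]; ring
    · simp [hx]
  rw [h, integral_add ((integrable_indicator_one hA).const_mul _) (integrable_const _),
    integral_const_mul, integral_indicator_one hA, integral_const, probReal_univ, one_smul]
  ring

omit [IsMarkovKernel κ] [IsProbabilityMeasure π] in
/-- `∫ 1_A · kop κ 1_A dπ = ∫_A κ(x, A) dπ` (the STAY MASS `s`). -/
theorem integral_indicator_mul_kop_indicator (hA : MeasurableSet A) :
    ∫ x, A.indicator (1 : Ω → ℝ) x * kop κ (A.indicator (1 : Ω → ℝ)) x ∂π
      = ∫ x in A, (κ x).real A ∂π := by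
  rw [← integral_indicator hA]
  refine integral_congr_ae (ae_of_all _ fun x => ?_)
  by_cases hx : x ∈ A
  · simp [hx, kop_indicator hA]
  · simp [hx]

/-- **`C_g(1) = s − a²`** with `s = ∫_A κ(x, A) dπ`: equivalently `1 − ρ₁ = (a − s)/(a(1 − a))` — the
lag-one decorrelation of a sector indicator is the normalised EXIT FLUX. -/
theorem autocov_centredIndicator_one (hπ : Kernel.Invariant κ π) (hA : MeasurableSet A) :
    autocov κ π (fun x => A.indicator (1 : Ω → ℝ) x - π.real A) 1
      = ∫ x in A, (κ x).real A ∂π - π.real A ^ 2 := by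
  set a := π.real A with ha
  have h1m : Measurable (A.indicator (1 : Ω → ℝ)) := measurable_const.indicator hA
  have h1b : ∀ x, |A.indicator (1 : Ω → ℝ) x| ≤ 1 := fun x => by
    by_cases hx : x ∈ A <;> simp [hx]
  have hshift := iterate_kop_sub_const (κ := κ) h1m h1b a 1
  simp only [Function.iterate_one] at hshift
  have hKm : Measurable (kop κ (A.indicator (1 : Ω → ℝ))) := measurable_kop κ h1m
  have hKb : ∀ x, |kop κ (A.indicator (1 : Ω → ℝ)) x| ≤ 1 := abs_kop_le κ h1b
  have hKi : Integrable (kop κ (A.indicator (1 : Ω → ℝ))) π := integrable_of_bounded π hKm hKb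
  have h1i : Integrable (A.indicator (1 : Ω → ℝ)) π := integrable_indicator_one hA
  have hprod : Integrable (fun x => A.indicator (1 : Ω → ℝ) x * kop κ (A.indicator (1 : Ω → ℝ)) x) π :=
    integrable_of_bounded π (h1m.mul hKm) (C := 1 * 1) fun x => by
      rw [abs_mul]; exact mul_le_mul (h1b x) (hKb x) (abs_nonneg _) zero_le_one
  have hK1 : ∫ x, kop κ (A.indicator (1 : Ω → ℝ)) x ∂π = a := by
    rw [integral_kop κ hπ h1m h1b, integral_indicator_one hA]
  unfold autocov
  rw [Function.iterate_one, hshift]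
  have hexp : (fun x => (A.indicator (1 : Ω → ℝ) x - a) * (kop κ (A.indicator (1 : Ω → ℝ)) x - a))
      = fun x => A.indicator (1 : Ω → ℝ) x * kop κ (A.indicator (1 : Ω → ℝ)) x
          - a * kop κ (A.indicator (1 : Ω → ℝ)) x - a * A.indicator (1 : Ω → ℝ) x + a ^ 2 := by
    funext x; ring
  have i1 : Integrable (fun x => A.indicator (1 : Ω → ℝ) x * kop κ (A.indicator (1 : Ω → ℝ)) x
      - a * kop κ (A.indicator (1 : Ω → ℝ)) x) π := hprod.sub (hKi.const_mul a)
  have i2 : Integrable (fun x => A.indicator (1 : Ω → ℝ) x * kop κ (A.indicator (1 : Ω → ℝ)) x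
      - a * kop κ (A.indicator (1 : Ω → ℝ)) x - a * A.indicator (1 : Ω → ℝ) x) π :=
    i1.sub (h1i.const_mul a)
  rw [hexp, integral_add i2 (integrable_const _), integral_sub i1 (h1i.const_mul a),
    integral_sub hprod (hKi.const_mul a), integral_const_mul, integral_const_mul, hK1,
    integral_indicator_one hA, integral_const, probReal_univ, one_smul,
    integral_indicator_mul_kop_indicator hA, ← ha]
  ring

omit [IsProbabilityMeasure π] in
/-- Dictionary to the pair laws: `∫_A κ(x, A) dπ = (π ⊗ₘ κ)(A ×ˢ A)` … -/
theorem stayMass_eq_compProd [SFinite π] (hA : MeasurableSet A) :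
    ∫ x in A, (κ x).real A ∂π = ((π ⊗ₘ κ) (A ×ˢ A)).toReal := by
  rw [Measure.compProd_apply_prod hA hA, ← integral_toReal
    ((Kernel.measurable_coe κ hA).aemeasurable.restrict) (ae_of_all _ fun x => measure_lt_top _ _)]
  rfl

/-- … and **the exit flux `a − s = (π ⊗ₘ κ)(A ×ˢ Aᶜ)`** — the stationary probability of a
tunnelling event `X₀ ∈ A, X₁ ∉ A` per step. -/
theorem flux_eq_compProd (hA : MeasurableSet A) :
    π.real A - ∫ x in A, (κ x).real A ∂π = ((π ⊗ₘ κ) (A ×ˢ Aᶜ)).toReal := by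
  have hsplit : ∀ x, (κ x).real A + (κ x).real Aᶜ = 1 := fun x => by
    rw [← measureReal_union disjoint_compl_right hA.compl, Set.union_compl_self, probReal_univ]
  have h1 : ∫ x in A, (κ x).real Aᶜ ∂π = ((π ⊗ₘ κ) (A ×ˢ Aᶜ)).toReal := by
    rw [Measure.compProd_apply_prod hA hA.compl, ← integral_toReal
      ((Kernel.measurable_coe κ hA.compl).aemeasurable.restrict)
      (ae_of_all _ fun x => measure_lt_top _ _)]
    rfl
  have hiA : Integrable (fun x => (κ x).real A) (π.restrict A) :=
    integrable_of_bounded _ (Kernel.measurable_coe κ hA).ennreal_toReal (C := 1) fun x => by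
      rw [abs_of_nonneg measureReal_nonneg]; exact measureReal_le_one
  have hiAc : Integrable (fun x => (κ x).real Aᶜ) (π.restrict A) :=
    integrable_of_bounded _ (Kernel.measurable_coe κ hA.compl).ennreal_toReal (C := 1) fun x => by
      rw [abs_of_nonneg measureReal_nonneg]; exact measureReal_le_one
  have hsum : ∫ x in A, (κ x).real A ∂π + ∫ x in A, (κ x).real Aᶜ ∂π = π.real A := by
    rw [← integral_add hiA hiAc]
    simp_rw [hsplit]
    rw [integral_const, smul_eq_mul, mul_one]
    simp only [measureReal_def, Measure.restrict_apply_univ]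
  linarith

end Indicator

/-! ### §2 The bottleneck floor for reversible exact samplers -/

section Bottleneck

variable {κ : Kernel Ω Ω} [IsMarkovKernel κ] {π : Measure Ω} [IsProbabilityMeasure π] {A : Set Ω}

/-- The algebra of the floor: with `ρ₁ = (s − a²)/(a(1 − a))`,
`(1 + ρ₁)/(2(1 − ρ₁)) = a(1 − a)/(a − s) − 1/2`. -/
theorem bottleneck_floor_algebra {a s : ℝ} (ha0 : 0 < a) (ha1 : a < 1) (hsa : s < a) :
    (1 + (s - a ^ 2) / (a * (1 - a))) / (2 * (1 - (s - a ^ 2) / (a * (1 - a))))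
      = a * (1 - a) / (a - s) - 1 / 2 := by
  have hne : a - s ≠ 0 := by linarith
  have hna : a ≠ 0 := ha0.ne'
  have hn1 : 1 - a ≠ 0 := by linarith
  rw [div_eq_iff (by
    have : 0 < 1 - (s - a ^ 2) / (a * (1 - a)) := by
      rw [sub_pos, div_lt_one (mul_pos ha0 (by linarith))]; nlinarith
    positivity)]
  field_simp
  ring

/-- **THE BOTTLENECK FLOOR.**  `κ` Markov and `π`-reversible, `A` a sector with `a = π(A) ∈ (0, 1)`,
stay mass `s = ∫_A κ(x, A) dπ < a` (positive exit flux) and a summable autocorrelation of the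
indicator: `a(1 − a)/(a − s) − 1/2 ≤ τ_int(1_A)` — the sector indicator of EVERY reversible exact
sampler has integrated autocorrelation time at least (equilibrium mass × complement mass)/(exit
flux per step), minus one half. -/
theorem tauInt_sector_ge_bottleneck (hrev : Kernel.IsReversible κ π) (hA : MeasurableSet A)
    (ha0 : 0 < π.real A) (ha1 : π.real A < 1) (hflux : ∫ x in A, (κ x).real A ∂π < π.real A)
    (hs : Summable fun t =>
      autocov κ π (fun x => A.indicator (1 : Ω → ℝ) x - π.real A) (t + 1)
        / autocov κ π (fun x => A.indicator (1 : Ω → ℝ) x - π.real A) 0) :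
    π.real A * (1 - π.real A) / (π.real A - ∫ x in A, (κ x).real A ∂π) - 1 / 2
      ≤ tauInt (fun t => autocov κ π (fun x => A.indicator (1 : Ω → ℝ) x - π.real A) t
          / autocov κ π (fun x => A.indicator (1 : Ω → ℝ) x - π.real A) 0) := by
  set a := π.real A with ha
  set s := ∫ x in A, (κ x).real A ∂π with hsdef
  have h0 := autocov_centredIndicator_zero (κ := κ) (π := π) hA
  have h1 := autocov_centredIndicator_one hrev.invariant hA
  rw [← ha] at h0 h1
  rw [← hsdef] at h1
  have hvar : 0 < a * (1 - a) := mul_pos ha0 (by linarith)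
  have hρ1 : autocov κ π (fun x => A.indicator (1 : Ω → ℝ) x - a) 1
      / autocov κ π (fun x => A.indicator (1 : Ω → ℝ) x - a) 0 = (s - a ^ 2) / (a * (1 - a)) := by
    rw [h0, h1]
  have hlt : (s - a ^ 2) / (a * (1 - a)) < 1 := by
    rw [div_lt_one hvar]; nlinarith
  have key := tauInt_ge_of_isReversible hrev (measurable_centredIndicator hA a)
    (abs_centredIndicator_le (π := π) A) hs (by rw [hρ1]; exact hlt)
  rw [hρ1] at key
  rw [bottleneck_floor_algebra ha0 ha1 hflux] at key
  exact key

/-- Monotone form: any upper bound `T` on the exit flux `(π ⊗ₘ κ)(A ×ˢ Aᶜ)` gives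
`a(1 − a)/T − 1/2 ≤ τ_int(1_A)`. -/
theorem tauInt_sector_ge_of_flux_le (hrev : Kernel.IsReversible κ π) (hA : MeasurableSet A)
    (ha0 : 0 < π.real A) (ha1 : π.real A < 1) (hflux : ∫ x in A, (κ x).real A ∂π < π.real A)
    {T : ℝ≥0∞} (hT : (π ⊗ₘ κ) (A ×ˢ Aᶜ) ≤ T) (hTtop : T ≠ ⊤)
    (hs : Summable fun t =>
      autocov κ π (fun x => A.indicator (1 : Ω → ℝ) x - π.real A) (t + 1)
        / autocov κ π (fun x => A.indicator (1 : Ω → ℝ) x - π.real A) 0) :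
    π.real A * (1 - π.real A) / T.toReal - 1 / 2
      ≤ tauInt (fun t => autocov κ π (fun x => A.indicator (1 : Ω → ℝ) x - π.real A) t
          / autocov κ π (fun x => A.indicator (1 : Ω → ℝ) x - π.real A) 0) := by
  refine le_trans ?_ (tauInt_sector_ge_bottleneck hrev hA ha0 ha1 hflux hs)
  have hΦ := flux_eq_compProd (κ := κ) (π := π) hA
  have hpos : 0 < π.real A - ∫ x in A, (κ x).real A ∂π := by linarith
  have hle : π.real A - ∫ x in A, (κ x).real A ∂π ≤ T.toReal := by
    rw [hΦ]; exact ENNReal.toReal_mono hTtop hT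
  have hvar : 0 ≤ π.real A * (1 - π.real A) := mul_nonneg ha0.le (by linarith)
  linarith [div_le_div_of_nonneg_left hvar hpos hle]

/-- **Topological freezing, typed on the fitness.**  In theory-2's setting
(`Scaling/TunnellingLaws.lean`): `Q` a charge, `B` a set SEPARATING `Q` along the move relation `R`
(every allowed charge-changing move starts or ends in `B`), `κ` a `π`-reversible Markov kernel whose
moves are a.s. allowed.  Then for every sector `A = {Q ∈ S}` with `a = π(A) ∈ (0, 1)`, positive exit
flux and a summable indicator autocorrelation: `a(1 − a)/(2 π(B)) − 1/2 ≤ τ_int(1_A)` — the exact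
sampler pays the equilibrium mass of the region between the sectors in autocorrelation time. -/
theorem tauInt_sector_ge_of_separating {ι : Type*} {R : Ω → Ω → Prop} {Q : Ω → ι} {B : Set Ω}
    {S : Set ι} (hB : ∀ ⦃x y⦄, R x y → Q x ≠ Q y → x ∈ B ∨ y ∈ B)
    (hrev : Kernel.IsReversible κ π) (hR : ∀ᵐ p ∂(π ⊗ₘ κ), R p.1 p.2)
    (hA : MeasurableSet (Q ⁻¹' S)) (ha0 : 0 < π.real (Q ⁻¹' S)) (ha1 : π.real (Q ⁻¹' S) < 1)
    (hflux : ∫ x in Q ⁻¹' S, (κ x).real (Q ⁻¹' S) ∂π < π.real (Q ⁻¹' S))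
    (hs : Summable fun t =>
      autocov κ π (fun x => (Q ⁻¹' S).indicator (1 : Ω → ℝ) x - π.real (Q ⁻¹' S)) (t + 1)
        / autocov κ π (fun x => (Q ⁻¹' S).indicator (1 : Ω → ℝ) x - π.real (Q ⁻¹' S)) 0) :
    π.real (Q ⁻¹' S) * (1 - π.real (Q ⁻¹' S)) / (2 * π.real B) - 1 / 2
      ≤ tauInt (fun t =>
          autocov κ π (fun x => (Q ⁻¹' S).indicator (1 : Ω → ℝ) x - π.real (Q ⁻¹' S)) t
            / autocov κ π (fun x => (Q ⁻¹' S).indicator (1 : Ω → ℝ) x - π.real (Q ⁻¹' S)) 0) := by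
  have hsub : (Q ⁻¹' S) ×ˢ (Q ⁻¹' S)ᶜ ⊆ {p : Ω × Ω | Q p.1 ≠ Q p.2} := by
    rintro ⟨x, y⟩ ⟨hx, hy⟩ hq
    exact hy (by simpa [Set.mem_preimage, ← hq] using hx)
  have hT : (π ⊗ₘ κ) ((Q ⁻¹' S) ×ˢ (Q ⁻¹' S)ᶜ) ≤ 2 * π B :=
    (measure_mono hsub).trans
      (Theory2.Tunnelling.compProd_chargeChange_le_of_invariant hB π κ hrev.invariant hR)
  have h := tauInt_sector_ge_of_flux_le hrev hA ha0 ha1 hflux hT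
    (ENNReal.mul_ne_top ENNReal.ofNat_ne_top (measure_ne_top π B)) hs
  rwa [ENNReal.toReal_mul, ENNReal.toReal_ofNat, ← measureReal_def] at h

end Bottleneck

/-! ### §3 Mode collapse prices itself (the exact flow-MCMC kernel) -/

section ModeCollapse

variable {q : Measure Ω} [IsProbabilityMeasure q] {w : Ω → ℝ} {π : Measure Ω}
  [IsProbabilityMeasure π] {A : Set Ω}

/-- The exit flux of the flow-MCMC kernel from a sector is at most `π(A) · q(Aᶜ)`: the chain can only
leave `A` towards a proposal the MODEL makes (row 30's sector-entry bound, integrated). -/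
theorem indepMH_flux_le (hw : Measurable w) (hA : MeasurableSet A) :
    (π ⊗ₘ indepMH q w) (A ×ˢ Aᶜ) ≤ π A * q Aᶜ := by
  haveI : Fact (Measurable w) := ⟨hw⟩
  rw [Measure.compProd_apply_prod hA hA.compl]
  calc ∫⁻ x in A, indepMH q w x Aᶜ ∂π ≤ ∫⁻ _ in A, q Aᶜ ∂π := by
        refine setLIntegral_mono measurable_const fun x hx => ?_
        exact indepMH_apply_le_of_not_mem hw hA.compl (fun h => h hx)
    _ = π A * q Aᶜ := by rw [setLIntegral_const, mul_comm]

/-- **MODE COLLAPSE PRICES ITSELF.**  For the exact flow-MCMC kernel `indepMH q w` with target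
`π = w · q` (a probability law), every sector `A` with `a = π(A) ∈ (0, 1)`, positive exit flux and a
summable indicator autocorrelation satisfies `(1 − π(A))/q(Aᶜ) − 1/2 ≤ τ_int(1_A)`: a model that puts
mass `q(Aᶜ)` outside the sector forces the sector indicator's integrated autocorrelation time above
`(1 − π(A))/q(Aᶜ) − 1/2`, whatever the mean acceptance. -/
theorem indepMH_tauInt_sector_ge_modeCollapse (hw : Measurable w) (hw0 : ∀ x, 0 < w x)
    (hπ : (q.withDensity fun x => ENNReal.ofReal (w x)) = π) (hA : MeasurableSet A)
    (ha0 : 0 < π.real A) (ha1 : π.real A < 1)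
    (hflux : ∫ x in A, (indepMH q w x).real A ∂π < π.real A)
    (hs : Summable fun t =>
      autocov (indepMH q w) π (fun x => A.indicator (1 : Ω → ℝ) x - π.real A) (t + 1)
        / autocov (indepMH q w) π (fun x => A.indicator (1 : Ω → ℝ) x - π.real A) 0) :
    (1 - π.real A) / q.real Aᶜ - 1 / 2
      ≤ tauInt (fun t => autocov (indepMH q w) π (fun x => A.indicator (1 : Ω → ℝ) x - π.real A) t
          / autocov (indepMH q w) π (fun x => A.indicator (1 : Ω → ℝ) x - π.real A) 0) := by
  haveI : Fact (Measurable w) := ⟨hw⟩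
  have hrev : Kernel.IsReversible (indepMH q w) π := by
    rw [← hπ]; exact indepMH_isReversible hw hw0
  have h := tauInt_sector_ge_of_flux_le hrev hA ha0 ha1 hflux (indepMH_flux_le hw hA)
    (ENNReal.mul_ne_top (measure_ne_top π A) (measure_ne_top q Aᶜ)) hs
  have heq : π.real A * (1 - π.real A) / (π A * q Aᶜ).toReal = (1 - π.real A) / q.real Aᶜ := by
    rw [ENNReal.toReal_mul, ← measureReal_def, ← measureReal_def,
      mul_div_mul_left _ _ ha0.ne']
  rwa [heq] at h

end ModeCollapse

end Summit.Ventures.LatticeQCDFlow.Scoring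

end
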